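import Mathlib.Analysis.Convolution
import Mathlib.Analysis.Calculus.ContDiff.Operations
import Mathlib.Analysis.Calculus.SmoothSeries
import Mathlib.Analysis.Calculus.IteratedDeriv.Lemmas
import Mathlib.Analysis.Calculus.Deriv.Shift
import Mathlib.MeasureTheory.Integral.IntegralEqImproper
import Literature.Analysis.Convolution.DixmierMalliavin
import HarnessLib

/-!
# Dixmier–Malliavin on the real line, the FACTORIZATION STEP: from a kernel `f` with
# `Σ_j (−1)^j b_j f^{(2j)} → δ + h` to `φ = f ∗ Φ − h ∗ φ` — PROVED

Topic `Literature/Analysis/Convolution`.  Theorems only (no definition, no named fact).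

J. Dixmier, P. Malliavin, *Factorisations de fonctions et de vecteurs indéfiniment différentiables*,
Bull. Sci. Math. (2) **102** (1978) 305–330 [bib: `DixmierMalliavin1978`], §3, proof of Théorème 3.1,
in the one-dimensional case `G = ℝ`; D. Hegde, *Schwartz functions, Hadamard products, and the
Dixmier–Malliavin theorem*, arXiv:2103.05495 [bib: `Hegde2021`], §3.3, proof of Theorem 18 and
Remark 15: "any test function `φ` on the real line can be written as `φ = Φ ∗ f − h ∗ φ`".

**What is printed (Hegde2021 §3.3, for `G = ℝ`).**  "By lemma (bounds test) with bounds `b_j` we can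
find `f, h ∈ 𝒟` such that `Σ_{0≤j≤n} (−1)^j b_j f^{(2j)} → δ + h` as `n → ∞` in `𝒟′`. … Given `φ ∈ 𝒟(G)`,
on one hand `((Σ(−1)^j b_j x^{(2j)})·μ(x,f)) ∗ φ → φ + μ(x,h) ∗ φ`.  On the other hand,
`((Σ(−1)^j b_j x^{(2j)})·μ(x,f)) ∗ φ → μ(x,f) ∗ Φ` where `Φ = Σ_{j≥0} (−1)^j b_j φ^{(2j)}`.  Thus
`φ = −μ(x,h) ∗ φ + μ(x,f) ∗ Φ`."  Here (G = ℝ) `μ(x,f) = f`.  The coefficients are chosen "by a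
diagonal argument … `b_j` positive such that `Σ_j b_j M_{jℓ} < +∞` for all `ℓ`", `M_{jℓ}` the sup norms
of the derivatives `φ^{(2j+ℓ)}`, "this will show that various summations below will converge in the
space of test functions".

**What is here.**  The factorization step is proved ONCE AND FOR ALL against an explicit hypothesis
`H` describing the kernel package that the analytic half of the proof constructs
([Hegde2021, §3.1 Lemma 10, §3.2 Lemma 14]: `f = ωψ` with `ψ̂(ξ) = 1/Π_n (1 + ξ²/a_n²)`; companion
module `DixmierMalliavinKernel.lean`): for EVERY prescribed growth `M : ℕ → ℝ` there are
`0 ≤ b_j ≤ 1/M_j` and `f, h ∈ C_c^∞(ℝ; ℂ)` such that, for every test function `φ` and every `x`,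
`∫ (Σ_{j<n} (−1)^j b_j f^{(2j)}(y)) φ(x − y) dy → φ(x) + ∫ h(y) φ(x − y) dy` (`𝒟′`-convergence to
`δ + h`, tested on reflected translates of test functions).  From `H`:

* `integral_iteratedDeriv_mul_eq` — iterated integration by parts `∫ u^{(m)} v = (−1)^m ∫ u v^{(m)}` for
  `u ∈ C_c^∞`, `v ∈ C^∞`; `iteratedDeriv_comp_const_sub'` — `(d/dy)^m φ(x − y) = (−1)^m φ^{(m)}(x − y)`;
  hence `∫ F_n(y) φ(x − y) dy = ∫ f(y) Φ_n(x − y) dy` with `Φ_n = Σ_{j<n} (−1)^j b_j φ^{(2j)}`;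
* with `M_j := 2^j (1 + Σ_{m≤3j} ‖φ^{(m)}‖_∞)`: `b_j ‖φ^{(2j+k)}‖_∞ ≤ 2^{−j}` for `j ≥ k`, so
  `Φ := Σ_j (−1)^j b_j φ^{(2j)}` is `C^∞` (Mathlib `contDiff_tsum`) with support in `supp φ`, and
  `∫ f(y)Φ_n(x − y)dy → ∫ f(y)Φ(x − y)dy` (dominated convergence);
* `exists_sum_convolution_of_kernels` / `exists_fin_sum_convolution_of_kernels` — uniqueness of limits:
  **`φ = f ∗ Φ + (−h) ∗ φ`**, a sum of TWO convolutions of smooth compactly supported functions; the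
  `Fin N`-indexed form is literally the body of the named fact
  `Literature.Analysis.Convolution.DixmierMalliavin_real` (file `DixmierMalliavin.lean`), so that fact
  follows from `H`: `dixmierMalliavin_real_of_kernels`; the `_of_pos` variants ask `b_j M_j ≤ 1` only for
  `j ≥ 1` (`b_0 = 1` being forced by the normalisation of the kernel) — the form module A delivers.

First consumer: Connes–Consani 2021 Thm. 4.7 as printed
(`Literature.NumberTheory.ConnesConsani2021.CC2021_thm_4_7_of_sec2_sec4_of_factorization`).
-/

noncomputable section

open MeasureTheory Filter Set Function
open scoped ContDiff Convolution Topology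

namespace Literature.Analysis.Convolution

/-! ### Iterated derivatives of test functions -/

section Prelim

variable {φ : ℝ → ℂ}

/-- Derivatives of all orders of a smooth function are smooth. [folklore] -/
private theorem contDiff_iteratedDeriv_top (hφ : ContDiff ℝ ∞ φ) (m : ℕ) :
    ContDiff ℝ ∞ (iteratedDeriv m φ) := by
  rw [iteratedDeriv_eq_iterate]
  exact hφ.iterate_deriv m

/-- Derivatives of a compactly supported function are compactly supported. [folklore] -/
private theorem hasCompactSupport_iteratedDeriv_complex (hφc : HasCompactSupport φ) (m : ℕ) :
    HasCompactSupport (iteratedDeriv m φ) := by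
  induction m with
  | zero => simpa using hφc
  | succ m ih => rw [iteratedDeriv_succ]; exact ih.deriv

/-- All derivatives vanish off the topological support. [folklore] -/
private theorem iteratedDeriv_eq_zero_of_notMem_tsupport (m : ℕ) {x : ℝ} (hx : x ∉ tsupport φ) :
    iteratedDeriv m φ x = 0 := by
  have h : x ∉ support (iteratedFDeriv ℝ m φ) := fun h => hx (support_iteratedFDeriv_subset m h)
  rw [notMem_support] at h
  rw [iteratedDeriv_eq_iteratedFDeriv, h]
  simp

/-- The sup norms `‖φ^{(m)}‖_∞` of a test function are finite (the numbers `M_{jℓ}` of the printed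
proof). [folklore] -/
private theorem exists_bound_iteratedDeriv (hφ : ContDiff ℝ ∞ φ) (hφc : HasCompactSupport φ) (m : ℕ) :
    ∃ C : ℝ, 0 ≤ C ∧ ∀ x, ‖iteratedDeriv m φ x‖ ≤ C := by
  obtain ⟨C, hC⟩ := ((contDiff_iteratedDeriv_top hφ m).continuous).bounded_above_of_compact_support
    (hasCompactSupport_iteratedDeriv_complex hφc m)
  exact ⟨max C 0, le_max_right _ _, fun x => (hC x).trans (le_max_left _ _)⟩

/-- `(d/dy)^m [φ(x − y)] = (−1)^m φ^{(m)}(x − y)` — the sign bookkeeping when the derivatives of the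
kernel are moved onto the reflected translate of the test function ("on the other hand,
`(Σ(−1)^j b_j x^{(2j)}·μ(x,f)) ∗ φ → μ(x,f) ∗ Φ`", Hegde2021 §3.3).
[cite: Hegde2021, §3.3 proof of Thm. 18 (second displayed limit)] -/
theorem iteratedDeriv_comp_const_sub' (φ : ℝ → ℂ) (x : ℝ) (m : ℕ) :
    iteratedDeriv m (fun y => φ (x - y)) = fun y => (-1 : ℂ) ^ m * iteratedDeriv m φ (x - y) := by
  induction m with
  | zero => funext y; simp
  | succ m ih =>
    rw [iteratedDeriv_succ, ih]
    funext y
    rw [deriv_const_mul_field, pow_succ]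
    have := deriv_comp_const_sub (f := iteratedDeriv m φ) (a := x) (x := y)
    rw [this, iteratedDeriv_succ]
    ring

/-- **Iterated integration by parts**: for `u ∈ C_c^∞(ℝ)` and `v ∈ C^∞(ℝ)`,
`∫ u^{(m)}(y) v(y) dy = (−1)^m ∫ u(y) v^{(m)}(y) dy` (no boundary terms: `u` has compact support) — the
step `f^{(2j)} ∗ φ = f ∗ φ^{(2j)}` behind "`(Σ(−1)^j b_j x^{(2j)}·μ(x,f)) ∗ φ → μ(x,f) ∗ Φ` where
`Φ = Σ_{j≥0}(−1)^j b_j φ^{(2j)}`". [cite: Hegde2021, §3.3 proof of Thm. 18 (second displayed limit)] -/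
theorem integral_iteratedDeriv_mul_eq {u v : ℝ → ℂ} (hu : ContDiff ℝ ∞ u)
    (huc : HasCompactSupport u) (hv : ContDiff ℝ ∞ v) (m : ℕ) :
    ∫ y, iteratedDeriv m u y * v y = (-1 : ℂ) ^ m * ∫ y, u y * iteratedDeriv m v y := by
  induction m generalizing v with
  | zero => simp
  | succ m ih =>
    have hV : ContDiff ℝ ∞ (iteratedDeriv m u) := contDiff_iteratedDeriv_top hu m
    have hVc : HasCompactSupport (iteratedDeriv m u) := hasCompactSupport_iteratedDeriv_complex huc m
    have hVd : ∀ y, HasDerivAt (iteratedDeriv m u) (deriv (iteratedDeriv m u) y) y := fun y =>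
      ((hV.differentiable (by simp)) y).hasDerivAt
    have hvd : ∀ y, HasDerivAt v (deriv v y) y := fun y =>
      ((hv.differentiable (by simp)) y).hasDerivAt
    have hv' : ContDiff ℝ ∞ (deriv v) := by
      have := hv.iterate_deriv 1
      simpa using this
    -- integrability of the three products (continuous, compact support)
    have i1 : Integrable (v * deriv (iteratedDeriv m u)) :=
      ((hv.continuous).mul (hV.continuous_deriv (by simp))).integrable_of_hasCompactSupport
        hVc.deriv.mul_left
    have i2 : Integrable (deriv v * iteratedDeriv m u) :=
      ((hv'.continuous).mul hV.continuous).integrable_of_hasCompactSupport hVc.mul_left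
    have i3 : Integrable (v * iteratedDeriv m u) :=
      ((hv.continuous).mul hV.continuous).integrable_of_hasCompactSupport hVc.mul_left
    have ibp := integral_mul_deriv_eq_deriv_mul_of_integrable (u := v) (v := iteratedDeriv m u)
      (u' := deriv v) (v' := deriv (iteratedDeriv m u)) (fun y _ => hvd y) (fun y _ => hVd y) i1 i2 i3
    calc ∫ y, iteratedDeriv (m + 1) u y * v y
        = ∫ y, v y * deriv (iteratedDeriv m u) y := by
          rw [iteratedDeriv_succ]
          exact integral_congr_ae (Eventually.of_forall fun y => mul_comm _ _)
      _ = -∫ y, deriv v y * iteratedDeriv m u y := ibp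
      _ = -∫ y, iteratedDeriv m u y * deriv v y :=
          congrArg Neg.neg (integral_congr_ae (Eventually.of_forall fun y => mul_comm _ _))
      _ = -((-1 : ℂ) ^ m * ∫ y, u y * iteratedDeriv m (deriv v) y) := by rw [ih hv']
      _ = (-1 : ℂ) ^ (m + 1) * ∫ y, u y * iteratedDeriv (m + 1) v y := by
          rw [← iteratedDeriv_succ', pow_succ]
          ring

end Prelim

/-! ### The abstract Dixmier–Malliavin step -/

/-- **Dixmier–Malliavin for `ℝ`, the factorization step — core form.**  As
`exists_sum_convolution_of_kernels`, but the kernel package is only asked to satisfy `b_j M_j ≤ 1` for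
`j ≥ 1` (`b_0 = 1` is forced by the normalisation `Σ_j (−1)^j b_j f^{(2j)} → δ + h`, and the printed
choice "`Σ_j b_j M_{jℓ} < ∞` for all `ℓ`" only constrains the tail).  Every smooth compactly supported
`φ : ℝ → ℂ` is `f₁ ∗ ψ₁ + f₂ ∗ ψ₂` with `f_i, ψ_i` smooth compactly supported.
[cite: DixmierMalliavin1978, §3 Thm. 3.1 (proof, case G = ℝ)] [cite: Hegde2021, §3.3 proof of Thm. 18; Rem. 15] -/
theorem exists_sum_convolution_of_kernels_of_pos
    (H : ∀ M : ℕ → ℝ, ∃ (b : ℕ → ℝ) (f h : ℝ → ℂ),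
      (∀ j, 0 ≤ b j) ∧ (∀ j, 1 ≤ j → b j * M j ≤ 1) ∧ ContDiff ℝ ∞ f ∧ HasCompactSupport f ∧
      ContDiff ℝ ∞ h ∧ HasCompactSupport h ∧
      ∀ φ : ℝ → ℂ, ContDiff ℝ ∞ φ → HasCompactSupport φ → ∀ x : ℝ,
        Tendsto (fun n => ∫ y, (∑ j ∈ Finset.range n,
            (-1 : ℂ) ^ j * b j * iteratedDeriv (2 * j) f y) * φ (x - y))
          atTop (𝓝 (φ x + ∫ y, h y * φ (x - y))))
    {φ : ℝ → ℂ} (hφ : ContDiff ℝ ∞ φ) (hφc : HasCompactSupport φ) :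
    ∃ (f₁ ψ₁ f₂ ψ₂ : ℝ → ℂ),
      (ContDiff ℝ ∞ f₁ ∧ HasCompactSupport f₁) ∧ (ContDiff ℝ ∞ ψ₁ ∧ HasCompactSupport ψ₁) ∧
      (ContDiff ℝ ∞ f₂ ∧ HasCompactSupport f₂) ∧ (ContDiff ℝ ∞ ψ₂ ∧ HasCompactSupport ψ₂) ∧
      φ = f₁ ⋆[ContinuousLinearMap.mul ℂ ℂ, volume] ψ₁ + f₂ ⋆[ContinuousLinearMap.mul ℂ ℂ, volume] ψ₂ := by
  -- sup norms of the derivatives of `φ`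
  choose A hA0 hA using exists_bound_iteratedDeriv hφ hφc
  -- the prescribed growth: `M j = 2^j (1 + max_{m ≤ 3j} A m)`
  set T : ℕ → ℝ := fun j => ∑ m ∈ Finset.range (3 * j + 1), A m with hT
  have hT0 : ∀ j, 0 ≤ T j := fun j => Finset.sum_nonneg fun m _ => hA0 m
  have hAT : ∀ j m, m ≤ 3 * j → A m ≤ T j := fun j m hm =>
    Finset.single_le_sum (fun m _ => hA0 m) (Finset.mem_range.2 (Nat.lt_succ_of_le hm))
  obtain ⟨b, f, h, hb0, hbT, hf, hfc, hh, hhc, hlim⟩ := H fun j => 2 ^ j * (1 + T j)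
  -- the key summability: for every `k`, `Σ_j b_j A(k + 2j) < ∞` (indeed `≤ 2^{-j}` for `j ≥ max k 1`)
  have hsum : ∀ k : ℕ, Summable fun j => b j * A (k + 2 * j) := by
    intro k
    refine Summable.of_norm_bounded_eventually_nat (g := fun j : ℕ => ((1:ℝ) / 2) ^ j)
      (summable_geometric_of_lt_one (by norm_num) (by norm_num)) ?_
    filter_upwards [Filter.eventually_ge_atTop (max k 1)] with j hj
    have hjk : k ≤ j := le_trans (le_max_left _ _) hj
    have hj1 : 1 ≤ j := le_trans (le_max_right _ _) hj
    rw [Real.norm_eq_abs, abs_of_nonneg (mul_nonneg (hb0 j) (hA0 _))]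
    have h1 : A (k + 2 * j) ≤ T j := hAT j _ (by omega)
    have h2 : b j * A (k + 2 * j) ≤ b j * (1 + T j) :=
      mul_le_mul_of_nonneg_left (by linarith) (hb0 j)
    have h3 : b j * (1 + T j) * 2 ^ j ≤ 1 := by
      calc b j * (1 + T j) * 2 ^ j = b j * (2 ^ j * (1 + T j)) := by ring
        _ ≤ 1 := hbT j hj1
    have h4 : b j * (1 + T j) ≤ ((1:ℝ) / 2) ^ j := by
      rw [div_pow, one_pow, le_div_iff₀ (by positivity)]
      exact h3
    exact h2.trans h4
  -- the function `Φ = Σ_j (-1)^j b_j φ^{(2j)}`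
  set g : ℕ → ℝ → ℂ := fun j y => (-1 : ℂ) ^ j * b j * iteratedDeriv (2 * j) φ y with hg
  have hgs : ∀ j, ContDiff ℝ ∞ (g j) := fun j =>
    contDiff_const.mul (contDiff_iteratedDeriv_top hφ _)
  have hgbound : ∀ (k j : ℕ) (y : ℝ), ‖iteratedFDeriv ℝ k (g j) y‖ ≤ b j * A (k + 2 * j) := by
    intro k j y
    rw [norm_iteratedFDeriv_eq_norm_iteratedDeriv]
    have e0 : iteratedDeriv k (iteratedDeriv (2 * j) φ) = iteratedDeriv (k + 2 * j) φ := by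
      rw [iteratedDeriv_eq_iterate, iteratedDeriv_eq_iterate, iteratedDeriv_eq_iterate,
        Function.iterate_add_apply]
    have e : iteratedDeriv k (g j) y = (-1 : ℂ) ^ j * b j * iteratedDeriv (k + 2 * j) φ y := by
      rw [hg]
      simp only
      rw [iteratedDeriv_const_mul_field, ← e0]
    rw [e]
    simp only [norm_mul, norm_pow, norm_neg, norm_one, one_pow, one_mul, Complex.norm_real,
      Real.norm_eq_abs, abs_of_nonneg (hb0 j)]
    exact mul_le_mul_of_nonneg_left (hA _ _) (hb0 j)
  set Φ : ℝ → ℂ := fun y => ∑' j, g j y with hΦ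
  have hΦs : ContDiff ℝ ∞ Φ :=
    contDiff_tsum (N := (⊤ : ℕ∞)) hgs (fun k _ => hsum k) (fun k j y _ => hgbound k j y)
  have hΦc : HasCompactSupport Φ := by
    refine HasCompactSupport.intro hφc fun y hy => ?_
    rw [hΦ]
    simp only
    refine (tsum_congr fun j => ?_).trans tsum_zero
    rw [hg]
    simp only [iteratedDeriv_eq_zero_of_notMem_tsupport _ hy, mul_zero]
  -- partial sums converge pointwise, with a uniform bound
  have hgsum : ∀ y, Summable fun j => g j y := fun y => by
    refine Summable.of_norm_bounded (g := fun j => b j * A (0 + 2 * j)) (hsum 0) fun j => ?_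
    have := hgbound 0 j y
    rwa [norm_iteratedFDeriv_zero] at this
  have hΦn : ∀ y, Tendsto (fun n => ∑ j ∈ Finset.range n, g j y) atTop (𝓝 (Φ y)) := fun y =>
    (hgsum y).hasSum.tendsto_sum_nat
  have hΦbd : ∀ n y, ‖∑ j ∈ Finset.range n, g j y‖ ≤ ∑' j, b j * A (0 + 2 * j) := fun n y => by
    refine (norm_sum_le _ _).trans ?_
    refine (Finset.sum_le_sum fun j _ => ?_).trans
      ((hsum 0).sum_le_tsum (Finset.range n) fun j _ => mul_nonneg (hb0 j) (hA0 _))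
    have := hgbound 0 j y
    rwa [norm_iteratedFDeriv_zero] at this
  -- (1) move the derivatives across the convolution: `∫ F_n(y) φ(x-y) dy = ∫ f(y) Φ_n(x-y) dy`
  have hswap : ∀ (n : ℕ) (x : ℝ),
      (∫ y, (∑ j ∈ Finset.range n, (-1 : ℂ) ^ j * b j * iteratedDeriv (2 * j) f y) * φ (x - y)) =
        ∫ y, f y * ∑ j ∈ Finset.range n, g j (x - y) := by
    intro n x
    have hφx : ContDiff ℝ ∞ (fun y => φ (x - y)) := hφ.comp (contDiff_const.sub contDiff_id)
    -- termwise
    have hterm : ∀ j, (∫ y, ((-1 : ℂ) ^ j * b j * iteratedDeriv (2 * j) f y) * φ (x - y)) =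
        ∫ y, f y * g j (x - y) := by
      intro j
      have e1 := integral_iteratedDeriv_mul_eq hf hfc hφx (2 * j)
      rw [iteratedDeriv_comp_const_sub' φ x (2 * j)] at e1
      have hneg : ((-1 : ℂ) ^ (2 * j)) = 1 := by rw [pow_mul]; norm_num
      simp only [hneg, one_mul] at e1
      rw [hg]
      simp only
      calc (∫ y, (-1 : ℂ) ^ j * b j * iteratedDeriv (2 * j) f y * φ (x - y))
          = (-1 : ℂ) ^ j * b j * ∫ y, iteratedDeriv (2 * j) f y * φ (x - y) := by
            rw [← integral_const_mul]
            exact integral_congr_ae (Eventually.of_forall fun y => by ring)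
        _ = (-1 : ℂ) ^ j * b j * ∫ y, f y * iteratedDeriv (2 * j) φ (x - y) := by rw [e1]
        _ = ∫ y, f y * ((-1 : ℂ) ^ j * b j * iteratedDeriv (2 * j) φ (x - y)) := by
            rw [← integral_const_mul]
            exact integral_congr_ae (Eventually.of_forall fun y => by ring)
    -- integrability of each term (to distribute the finite sum)
    have hint : ∀ j, Integrable fun y => ((-1 : ℂ) ^ j * b j * iteratedDeriv (2 * j) f y) * φ (x - y) :=
      fun j => by
      refine Continuous.integrable_of_hasCompactSupport ?_ ?_
      · exact ((continuous_const.mul (contDiff_iteratedDeriv_top hf _).continuous).mul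
          (hφx.continuous))
      · exact ((hasCompactSupport_iteratedDeriv_complex hfc _).mul_left).mul_right
    have hint' : ∀ j, Integrable fun y => f y * g j (x - y) := fun j => by
      refine Continuous.integrable_of_hasCompactSupport ?_ hfc.mul_right
      exact hf.continuous.mul ((hgs j).continuous.comp (continuous_const.sub continuous_id))
    rw [show (fun y => (∑ j ∈ Finset.range n, (-1 : ℂ) ^ j * b j * iteratedDeriv (2 * j) f y) *
        φ (x - y)) = fun y => ∑ j ∈ Finset.range n, ((-1 : ℂ) ^ j * b j *
          iteratedDeriv (2 * j) f y) * φ (x - y) from funext fun y => Finset.sum_mul _ _ _,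
      integral_finsetSum _ (fun j _ => hint j),
      show (fun y => f y * ∑ j ∈ Finset.range n, g j (x - y)) =
        fun y => ∑ j ∈ Finset.range n, f y * g j (x - y) from funext fun y => Finset.mul_sum _ _ _,
      integral_finsetSum _ (fun j _ => hint' j)]
    exact Finset.sum_congr rfl fun j _ => hterm j
  -- (2) `∫ f(y) Φ_n(x-y) dy → ∫ f(y) Φ(x-y) dy` (dominated convergence)
  have hlim2 : ∀ x, Tendsto (fun n => ∫ y, f y * ∑ j ∈ Finset.range n, g j (x - y)) atTop
      (𝓝 (∫ y, f y * Φ (x - y))) := by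
    intro x
    refine tendsto_integral_of_dominated_convergence (fun y => ‖f y‖ * ∑' j, b j * A (0 + 2 * j))
      (fun n => ?_) ?_ (fun n => Eventually.of_forall fun y => ?_) (Eventually.of_forall fun y => ?_)
    · exact (hf.continuous.mul ((continuous_finsetSum _ fun j _ => (hgs j).continuous).comp
        (continuous_const.sub continuous_id))).aestronglyMeasurable
    · exact (hf.continuous.integrable_of_hasCompactSupport hfc).norm.mul_const _
    · rw [norm_mul]
      exact mul_le_mul_of_nonneg_left (hΦbd n (x - y)) (norm_nonneg _)
    · exact (hΦn (x - y)).const_mul (f y)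
  -- (3) compare the two limits
  have key : ∀ x, φ x + ∫ y, h y * φ (x - y) = ∫ y, f y * Φ (x - y) := by
    intro x
    have h1 := hlim φ hφ hφc x
    simp_rw [hswap] at h1
    exact tendsto_nhds_unique h1 (hlim2 x)
  -- (4) read off the factorization `φ = f ⋆ Φ + (-h) ⋆ φ`
  refine ⟨f, Φ, -h, φ, ⟨hf, hfc⟩, ⟨hΦs, hΦc⟩, ⟨hh.neg, hhc.neg⟩, ⟨hφ, hφc⟩, ?_⟩
  funext x
  rw [Pi.add_apply, convolution_def, convolution_def]
  simp only [ContinuousLinearMap.mul_apply', Pi.neg_apply, neg_mul]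
  rw [integral_neg, ← key x]
  ring

/-- **Dixmier–Malliavin for `ℝ`, the factorization step** ([DixmierMalliavin1978, §3, proof of
Thm. 3.1 for `G = ℝ`]; [Hegde2021, §3.3 proof of Thm. 18 and Rem. 15]: "any test function `φ` on the real
line can be written as `φ = Φ ∗ f − h ∗ φ`").  Hypothesis `H` is the kernel package of the analytic half
of the printed proof ([Hegde2021, §3.2 Lemma 14]: "Given a sequence of bounds `B_n > 0`, there exists a
sequence of constants `0 < b_n < B_n` and a function `f ∈ 𝒟` such that `Σ_{j≤n}(−1)^j b_j f^{(2j)} → δ + h`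
(in `𝒟′`) as `n → ∞` for some `h ∈ 𝒟`"), with the `𝒟′`-convergence tested on the reflected translates
`y ↦ φ(x − y)` of test functions — exactly what the proof uses.  CONCLUSION: every smooth compactly
supported `φ : ℝ → ℂ` is `f₁ ∗ ψ₁ + f₂ ∗ ψ₂` with `f_i, ψ_i` smooth compactly supported (namely
`f ∗ Φ + (−h) ∗ φ`, `Φ = Σ_j (−1)^j b_j φ^{(2j)} ∈ C_c^∞`, `supp Φ ⊆ supp φ`).  Proof as printed: the
growth `M_j = 2^j(1 + Σ_{m≤3j}‖φ^{(m)}‖_∞)` handed to `H` makes `Σ_j b_j‖φ^{(2j+k)}‖_∞ < ∞` for every `k`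
("by a diagonal argument … `Σ_j b_j M_{jℓ} < +∞` for all `ℓ`"), so `Φ ∈ C^∞` (`contDiff_tsum`);
`∫F_nφ(x−·) = ∫fΦ_n(x−·)` (`integral_iteratedDeriv_mul_eq`); dominated convergence; uniqueness of limits.
[cite: DixmierMalliavin1978, §3 Thm. 3.1 (proof, case G = ℝ)] [cite: Hegde2021, §3.3 proof of Thm. 18; Rem. 15] -/
theorem exists_sum_convolution_of_kernels
    (H : ∀ M : ℕ → ℝ, ∃ (b : ℕ → ℝ) (f h : ℝ → ℂ),
      (∀ j, 0 ≤ b j ∧ b j * M j ≤ 1) ∧ ContDiff ℝ ∞ f ∧ HasCompactSupport f ∧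
      ContDiff ℝ ∞ h ∧ HasCompactSupport h ∧
      ∀ φ : ℝ → ℂ, ContDiff ℝ ∞ φ → HasCompactSupport φ → ∀ x : ℝ,
        Tendsto (fun n => ∫ y, (∑ j ∈ Finset.range n,
            (-1 : ℂ) ^ j * b j * iteratedDeriv (2 * j) f y) * φ (x - y))
          atTop (𝓝 (φ x + ∫ y, h y * φ (x - y))))
    {φ : ℝ → ℂ} (hφ : ContDiff ℝ ∞ φ) (hφc : HasCompactSupport φ) :
    ∃ (f₁ ψ₁ f₂ ψ₂ : ℝ → ℂ),
      (ContDiff ℝ ∞ f₁ ∧ HasCompactSupport f₁) ∧ (ContDiff ℝ ∞ ψ₁ ∧ HasCompactSupport ψ₁) ∧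
      (ContDiff ℝ ∞ f₂ ∧ HasCompactSupport f₂) ∧ (ContDiff ℝ ∞ ψ₂ ∧ HasCompactSupport ψ₂) ∧
      φ = f₁ ⋆[ContinuousLinearMap.mul ℂ ℂ, volume] ψ₁ + f₂ ⋆[ContinuousLinearMap.mul ℂ ℂ, volume] ψ₂ := by
  refine exists_sum_convolution_of_kernels_of_pos (fun M => ?_) hφ hφc
  obtain ⟨b, f, h, hb, hf, hfc, hh, hhc, hlim⟩ := H M
  exact ⟨b, f, h, fun j => (hb j).1, fun j _ => (hb j).2, hf, hfc, hh, hhc, hlim⟩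

/-- **Core form in the `Fin N`-indexed shape of `DixmierMalliavin_real`** (kernel package with
`b_j M_j ≤ 1` for `j ≥ 1` only). [cite: DixmierMalliavin1978, §3 Thm. 3.1 (proof, case G = ℝ)] [cite: Hegde2021, Thm. 18 and Rem. 15] -/
theorem exists_fin_sum_convolution_of_kernels_of_pos
    (H : ∀ M : ℕ → ℝ, ∃ (b : ℕ → ℝ) (f h : ℝ → ℂ),
      (∀ j, 0 ≤ b j) ∧ (∀ j, 1 ≤ j → b j * M j ≤ 1) ∧ ContDiff ℝ ∞ f ∧ HasCompactSupport f ∧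
      ContDiff ℝ ∞ h ∧ HasCompactSupport h ∧
      ∀ φ : ℝ → ℂ, ContDiff ℝ ∞ φ → HasCompactSupport φ → ∀ x : ℝ,
        Tendsto (fun n => ∫ y, (∑ j ∈ Finset.range n,
            (-1 : ℂ) ^ j * b j * iteratedDeriv (2 * j) f y) * φ (x - y))
          atTop (𝓝 (φ x + ∫ y, h y * φ (x - y))))
    {φ : ℝ → ℂ} (hφ : ContDiff ℝ ∞ φ) (hφc : HasCompactSupport φ) :
    ∃ (N : ℕ) (f ψ : Fin N → ℝ → ℂ),
      (∀ i, ContDiff ℝ ∞ (f i) ∧ HasCompactSupport (f i)) ∧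
      (∀ i, ContDiff ℝ ∞ (ψ i) ∧ HasCompactSupport (ψ i)) ∧
      φ = ∑ i, (f i ⋆[ContinuousLinearMap.mul ℂ ℂ, volume] ψ i) := by
  obtain ⟨f₁, ψ₁, f₂, ψ₂, h₁, h₂, h₃, h₄, hφeq⟩ := exists_sum_convolution_of_kernels_of_pos H hφ hφc
  refine ⟨2, ![f₁, f₂], ![ψ₁, ψ₂], ?_, ?_, ?_⟩
  · intro i; fin_cases i <;> simpa
  · intro i; fin_cases i <;> simpa
  · rw [Fin.sum_univ_two]
    simpa using hφeq

/-- **The same conclusion in the `Fin N`-indexed shape of the named fact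
`Literature.Analysis.Convolution.DixmierMalliavin_real`** (with `N = 2`): every smooth compactly
supported `φ : ℝ → ℂ` is `Σ_{i<N} f_i ∗ ψ_i` with `f_i, ψ_i` smooth compactly supported, from the
kernel package `H`.  [cite: DixmierMalliavin1978, §3 Thm. 3.1 (proof, case G = ℝ)] [cite: Hegde2021, Thm. 18 and Rem. 15] -/
theorem exists_fin_sum_convolution_of_kernels
    (H : ∀ M : ℕ → ℝ, ∃ (b : ℕ → ℝ) (f h : ℝ → ℂ),
      (∀ j, 0 ≤ b j ∧ b j * M j ≤ 1) ∧ ContDiff ℝ ∞ f ∧ HasCompactSupport f ∧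
      ContDiff ℝ ∞ h ∧ HasCompactSupport h ∧
      ∀ φ : ℝ → ℂ, ContDiff ℝ ∞ φ → HasCompactSupport φ → ∀ x : ℝ,
        Tendsto (fun n => ∫ y, (∑ j ∈ Finset.range n,
            (-1 : ℂ) ^ j * b j * iteratedDeriv (2 * j) f y) * φ (x - y))
          atTop (𝓝 (φ x + ∫ y, h y * φ (x - y))))
    {φ : ℝ → ℂ} (hφ : ContDiff ℝ ∞ φ) (hφc : HasCompactSupport φ) :
    ∃ (N : ℕ) (f ψ : Fin N → ℝ → ℂ),
      (∀ i, ContDiff ℝ ∞ (f i) ∧ HasCompactSupport (f i)) ∧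
      (∀ i, ContDiff ℝ ∞ (ψ i) ∧ HasCompactSupport (ψ i)) ∧
      φ = ∑ i, (f i ⋆[ContinuousLinearMap.mul ℂ ℂ, volume] ψ i) := by
  obtain ⟨f₁, ψ₁, f₂, ψ₂, h₁, h₂, h₃, h₄, hφeq⟩ := exists_sum_convolution_of_kernels H hφ hφc
  refine ⟨2, ![f₁, f₂], ![ψ₁, ψ₂], ?_, ?_, ?_⟩
  · intro i; fin_cases i <;> simpa
  · intro i; fin_cases i <;> simpa
  · rw [Fin.sum_univ_two]
    simpa using hφeq

/-- **The named fact `DixmierMalliavin_real` ([DixmierMalliavin1978, Thm. 3.1] for `G = ℝ`) FROM THE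
KERNEL PACKAGE `H`** — the analytic half of the printed proof ([Hegde2021, §3.1 Lemma 10, §3.2 Lemma 14]:
`f = ωψ`, `ψ̂ = 1/Π_n(1 + ξ²/a_n²)`, `Σ_{j≤n}(−1)^j b_j f^{(2j)} → δ + h`) is exactly what remains to
discharge it. [cite: DixmierMalliavin1978, §3 Thm. 3.1 (proof, case G = ℝ)] [cite: Hegde2021, §3.3 proof of Thm. 18] -/
theorem dixmierMalliavin_real_of_kernels
    (H : ∀ M : ℕ → ℝ, ∃ (b : ℕ → ℝ) (f h : ℝ → ℂ),
      (∀ j, 0 ≤ b j ∧ b j * M j ≤ 1) ∧ ContDiff ℝ ∞ f ∧ HasCompactSupport f ∧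
      ContDiff ℝ ∞ h ∧ HasCompactSupport h ∧
      ∀ φ : ℝ → ℂ, ContDiff ℝ ∞ φ → HasCompactSupport φ → ∀ x : ℝ,
        Tendsto (fun n => ∫ y, (∑ j ∈ Finset.range n,
            (-1 : ℂ) ^ j * b j * iteratedDeriv (2 * j) f y) * φ (x - y))
          atTop (𝓝 (φ x + ∫ y, h y * φ (x - y)))) :
    DixmierMalliavin_real :=
  fun _ hφ hφc => exists_fin_sum_convolution_of_kernels H hφ hφc

/-- **`DixmierMalliavin_real` from the core kernel package** (`b_j M_j ≤ 1` for `j ≥ 1` only; `b_0`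
free — this is the form module A (`DixmierMalliavinKernel.lean`) delivers, with `b_0 = 1`).
[cite: DixmierMalliavin1978, §3 Thm. 3.1 (proof, case G = ℝ)] [cite: Hegde2021, §3.3 proof of Thm. 18] -/
theorem dixmierMalliavin_real_of_kernels_of_pos
    (H : ∀ M : ℕ → ℝ, ∃ (b : ℕ → ℝ) (f h : ℝ → ℂ),
      (∀ j, 0 ≤ b j) ∧ (∀ j, 1 ≤ j → b j * M j ≤ 1) ∧ ContDiff ℝ ∞ f ∧ HasCompactSupport f ∧
      ContDiff ℝ ∞ h ∧ HasCompactSupport h ∧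
      ∀ φ : ℝ → ℂ, ContDiff ℝ ∞ φ → HasCompactSupport φ → ∀ x : ℝ,
        Tendsto (fun n => ∫ y, (∑ j ∈ Finset.range n,
            (-1 : ℂ) ^ j * b j * iteratedDeriv (2 * j) f y) * φ (x - y))
          atTop (𝓝 (φ x + ∫ y, h y * φ (x - y)))) :
    DixmierMalliavin_real :=
  fun _ hφ hφc => exists_fin_sum_convolution_of_kernels_of_pos H hφ hφc

end Literature.Analysis.Convolution

end
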